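import Summits.MatrixMultiplication.MatrixMultiplication.Theorems.ObstructionDescentUniversalOccurrenceTwoRectangleHookTableaux

set_option linter.dupNamespace false
set_option autoImplicit false

/-!
# Universal occurrence — two rectangles and a HOOK, part D: `((2^N),(2^N),(2N-2,2))` and `((2^N),(2^N),(2N))` (decomp-mm · lens 3 · gen 43)

Route `route-MatrixMultiplication-ObstructionDescent` (sub-problem `MatrixMultiplication`, `ω(ℂ) = 2`); SUPPORT for the crux
`NoOccurrenceObstruction` (`P_O`, item `stmt-MatrixMultiplication-29040`) through the universal-occurrence programme (NODE-g29…g43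
of the decomp-mm cell, lens 3).  Nothing here proves `ω = 2` or closes an item; no `def`, no `sorry`, standard axioms.  Closure
currency as in parts I–IX: "the triple `(λ⁰,λ¹,λ²)` occurs for `s`" is `isotypicSum₁ λ⁰ (isotypicSum₂ λ¹ (isotypicSum₃ λ² (s^{⊗d}))) ≠ 0`.

**This file.**  The two-row and one-row ends of the hook family, by the same twin-column certificates (tools of part A), so that
part E can state the family `j ≤ 3` uniformly: `occurs_unitTensor_twoRectangle_doubleHook_one` (`m ≥ N ≥ 2`; `e = e_std ∘ (2 3)`, core
columns `[(0,s₀),(1,s₀)] ‖ [(1,s₁),(0,s₁)]`, no twist — every pair `σ` is valid and the twin property is forced by the unique slot of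
colour `1`; sum `= 2((N-1)!)²`) and `occurs_unitTensor_twoRectangle_doubleHook_zero` (`m ≥ N ≥ 1`; all colours `0`, every summand
`= 1`, sum `= (N!)²`).  (Two-row types of this sector are in the Chow image; the point here is the uniform certificate shape.)

[cite: BurgisserIkenmeyer2011, §3.4 (Prop. 3.4), Thm. 4.4] [cite: BurgisserIkenmeyer2017, §5, Thm. 5.9 (proof of (2)), eq. (3.4)]
[cite: Landsberg2017, §9.1.1]
-/

noncomputable section

open scoped BigOperators

namespace Summit.MatrixMultiplication.MatrixMultiplication.Theorems.ObstructionCalculus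

open Literature.Computability.AlgebraicComplexity
open Literature.NumberTheory.DiophantineGeometry

/-! ### §6 The certificates for `ν = (2N-2, 2)` and `ν = (2N)`: core `[(0,s₀),(1,s₀)]`, `[(1,s₁),(0,s₁)]` (no twist),
resp. `[(0,s₀)]`, `[(1,s₀)]` -/

set_option maxHeartbeats 400000 in
/-- `((2^N),(2^N),(2N-2,2))` occurs for `⟨m⟩` for all `m ≥ N ≥ 2` (two rows; here every block pair is valid and the twin
property is forced by the unique slot of colour `1`). [cite: BurgisserIkenmeyer2011, Thm. 4.4] -/
theorem occurs_unitTensor_twoRectangle_doubleHook_one {N m : ℕ} (hN : 2 ≤ N) (hNm : N ≤ m)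
    {lam : Fin 3 → Nat.Partition (N * 2)} (h0 : lam 0 = Nat.Partition.rectangle N 2)
    (h1 : lam 1 = Nat.Partition.rectangle N 2)
    (h2 : (lam 2).sortedParts = (2 * N - 2 * 1) :: List.replicate 1 2) :
    isotypicSum₁ (lam 0) (isotypicSum₂ (lam 1) (isotypicSum₃ (lam 2)
      (kroneckerPow (unitTensor ℂ m) (N * 2)))) ≠ 0 := by
  classical
  have hNY : ∀ x ∈ (lam 2).youngDiagram.cells, x.1 < N := fun x hx => by
    have := fst_lt_of_mem_youngDiagram_doubleHook (lam 2) h2 hx; omega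
  have hd : (lam 2).youngDiagram.cells.card = N * 2 := Nat.Partition.card_cells_youngDiagram _
  obtain ⟨T, hT⟩ : ∃ T : StdFilling (N * 2) (lam 2).youngDiagram, ∀ p : Fin (N * 2), T.1 p =
      (if (p : ℕ) < 1 + 1 then ((p : ℕ), 0) else if (p : ℕ) < 2 * (1 + 1) then ((p : ℕ) - (1 + 1), 1)
        else (0, (p : ℕ) - 2 * (1 + 1) + 2)) :=
    ⟨⟨fun p => if (p : ℕ) < 1 + 1 then ((p : ℕ), 0) else if (p : ℕ) < 2 * (1 + 1) then ((p : ℕ) - (1 + 1), 1)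
        else (0, (p : ℕ) - 2 * (1 + 1) + 2),
      ⟨fun p => hookCell_mem_doubleHook (j := 1) hN (lam 2) h2 p p.2,
       fun p q hpq => Fin.ext (hookCell_injective (1 + 1) hpq),
       fun p q hpq => hookCell_standard (1 + 1) hpq⟩⟩, fun p => rfl⟩
  have hrowT : ∀ q : Fin (N * 2), (T.1 q).1 =
      if (q : ℕ) < 1 + 1 then (q : ℕ) else if (q : ℕ) < 2 * (1 + 1) then (q : ℕ) - (1 + 1) else 0 := fun q => by
    rw [hT]; split_ifs <;> rfl
  have hM : StdFilling.polytabloid ℂ hNY T ∈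
      highestWeightSpace (wordRep ℂ N (N * 2)) (Weight.ofPartition N (lam 2)) := by
    rw [← ydWeight_youngDiagram]; exact StdFilling.polytabloid_mem hNY T hd
  obtain ⟨s0, hs0⟩ : ∃ s : Fin N, (s : ℕ) = 0 := ⟨⟨0, by omega⟩, rfl⟩
  obtain ⟨s1, hs1⟩ : ∃ s : Fin N, (s : ℕ) = 1 := ⟨⟨1, by omega⟩, rfl⟩
  obtain ⟨p2, hp2⟩ : ∃ p : Fin (N * 2), (p : ℕ) = 2 := ⟨⟨2, by omega⟩, rfl⟩
  obtain ⟨p3, hp3⟩ : ∃ p : Fin (N * 2), (p : ℕ) = 3 := ⟨⟨3, by omega⟩, rfl⟩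
  obtain ⟨ξ, hξ⟩ : ∃ ξ : Equiv.Perm (Fin (N * 2)), ξ = Equiv.swap p2 p3 := ⟨_, rfl⟩
  have hξv : ∀ q : Fin (N * 2), ((ξ q : Fin (N * 2)) : ℕ) =
      if (q : ℕ) = 2 then 3 else if (q : ℕ) = 3 then 2 else (q : ℕ) := by
    intro q
    rw [hξ, Equiv.swap_apply_def]
    simp only [Fin.ext_iff, hp2, hp3]
    split_ifs <;> omega
  obtain ⟨e, he⟩ : ∃ e : Fin (N * 2) ≃ Fin 2 × Fin N,
      e = ξ.trans (finProdFinEquiv.symm.trans (Equiv.prodComm (Fin N) (Fin 2))) := ⟨_, rfl⟩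
  have hev : ∀ q : Fin (N * 2), (((e q).1 : Fin 2) : ℕ) = ((ξ q : Fin (N * 2)) : ℕ) % 2 ∧
      (((e q).2 : Fin N) : ℕ) = ((ξ q : Fin (N * 2)) : ℕ) / 2 := by
    intro q; rw [he]; simp [Fin.modNat, Fin.divNat]
  obtain ⟨H, hH⟩ : ∃ H : Finset (Fin N), H = ∅ := ⟨_, rfl⟩
  have hHv : ∀ s : Fin N, s ∈ H ↔ False := by intro s; rw [hH]; simp
  obtain ⟨e', he'⟩ : ∃ e' : Fin (N * 2) ≃ Fin 2 × Fin N,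
      ∀ q, e' q = (if (e q).2 ∈ H then Fin.rev (e q).1 else (e q).1, (e q).2) :=
    ⟨e, fun q => by rw [if_neg (fun h => (hHv _).1 h)]⟩
  obtain ⟨g, hg⟩ : ∃ g : Fin N → Fin N, ∀ i, g i = if (i : ℕ) ≤ 1 then i else s0 := ⟨_, fun i => rfl⟩
  have hgv : ∀ i : Fin N, ((g i : Fin N) : ℕ) = if (i : ℕ) ≤ 1 then (i : ℕ) else 0 := by
    intro i; rw [hg]; split_ifs <;> omega
  have hginj : ∀ i i' : Fin N, g i = g i' → ((g i : Fin N) : ℕ) ≠ 0 → i = i' := by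
    intro i i' hii' hne
    have h1 := hgv i
    have h2 := hgv i'
    rw [hii'] at h1 hne
    apply Fin.ext
    split_ifs at h1 h2 <;> omega
  have hpos : ∀ (σ : Fin 2 → Equiv.Perm (Fin N)) (n : ℕ) (hn : n < N * 2) (a : Fin 2) (s : Fin N),
      (if n = 2 then 3 else if n = 3 then 2 else n) % 2 = (a : ℕ) →
      (if n = 2 then 3 else if n = 3 then 2 else n) / 2 = (s : ℕ) →
      (g ∘ fun q => σ (e q).1 (e q).2) ⟨n, hn⟩ = g (σ a s) := by
    intro σ n hn a s ha hs
    obtain ⟨h1, h2⟩ := hev ⟨n, hn⟩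
    rw [hξv] at h1 h2
    dsimp only at h1 h2
    have ha' : (e ⟨n, hn⟩).1 = a := Fin.ext (by rw [h1, ha])
    have hs' : (e ⟨n, hn⟩).2 = s := Fin.ext (by rw [h2, hs])
    show g (σ (e ⟨n, hn⟩).1 (e ⟨n, hn⟩).2) = _
    rw [ha', hs']
  have hVAL : ∀ σ : Fin 2 → Equiv.Perm (Fin N),
      StdFilling.polytabloid ℂ hNY T (g ∘ fun q => σ (e q).1 (e q).2) ≠ 0 →
      StdFilling.polytabloid ℂ hNY T (g ∘ fun q => σ (e q).1 (e q).2) = 1 := by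
    intro σ hz
    obtain ⟨harm, hlt, hinj0, hinj1⟩ := hookTableau_support hNY T hT hz
    have u0 := hpos σ 0 (by omega) 0 s0 (by norm_num) (by norm_num [hs0])
    have u1 := hpos σ 1 (by omega) 1 s0 (by norm_num) (by norm_num [hs0])
    have u2 := hpos σ 2 (by omega) 1 s1 (by norm_num) (by norm_num [hs1])
    have u3 := hpos σ 3 (by omega) 0 s1 (by norm_num) (by norm_num [hs1])
    have hl0 := hlt ⟨0, by omega⟩ (by norm_num)
    have hl1 := hlt ⟨1, by omega⟩ (by norm_num)
    have hl2 := hlt ⟨2, by omega⟩ (by norm_num)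
    have hl3 := hlt ⟨3, by omega⟩ (by norm_num)
    rw [u0] at hl0
    rw [u1] at hl1
    rw [u2] at hl2
    rw [u3] at hl3
    have hA01 : ((g (σ 0 s0) : Fin N) : ℕ) = ((g (σ 0 s1) : Fin N) : ℕ) → ((g (σ 0 s0) : Fin N) : ℕ) = 0 := by
      intro h; by_contra hne
      have := (σ 0).injective (hginj _ _ (Fin.ext h) hne)
      rw [Fin.ext_iff, hs0, hs1] at this; omega
    have hB01 : ((g (σ 1 s0) : Fin N) : ℕ) = ((g (σ 1 s1) : Fin N) : ℕ) → ((g (σ 1 s0) : Fin N) : ℕ) = 0 := by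
      intro h; by_contra hne
      have := (σ 1).injective (hginj _ _ (Fin.ext h) hne)
      rw [Fin.ext_iff, hs0, hs1] at this; omega
    have hc01 : ((g (σ 0 s0) : Fin N) : ℕ) ≠ ((g (σ 1 s0) : Fin N) : ℕ) := by
      intro h
      have := hinj0 ⟨0, by omega⟩ ⟨1, by omega⟩ (by norm_num) (by norm_num) (by rw [u0, u1]; exact Fin.ext h)
      simp [Fin.ext_iff] at this
    have hc23 : ((g (σ 1 s1) : Fin N) : ℕ) ≠ ((g (σ 0 s1) : Fin N) : ℕ) := by
      intro h
      have := hinj1 ⟨2, by omega⟩ ⟨3, by omega⟩ (by norm_num) (by norm_num) (by norm_num) (by norm_num)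
        (by rw [u2, u3]; exact Fin.ext h)
      simp [Fin.ext_iff] at this
    have E2 : ((g (σ 1 s1) : Fin N) : ℕ) = ((g (σ 0 s0) : Fin N) : ℕ) := by omega
    have E3 : ((g (σ 0 s1) : Fin N) : ℕ) = ((g (σ 1 s0) : Fin N) : ℕ) := by omega
    apply hookTableau_twin_eq_one hNY T hT (by omega) harm (fun p hp => hlt p (by omega)) hinj0
    intro p hp
    obtain ⟨n, hn⟩ := p
    dsimp only at hp ⊢
    have hn2 : n = 0 ∨ n = 1 := by omega
    rcases hn2 with rfl | rfl
    · rw [u0]; exact (u2.trans (Fin.ext E2))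
    · rw [u1]; exact (u3.trans (Fin.ext E3))
  have hterm : ∀ σ : Fin 2 → Equiv.Perm (Fin N),
      (∏ a, ((Equiv.Perm.sign (σ a) : ℤ) : ℂ)) *
          (wordBlockSign ℂ e' (fun q => σ (e q).1 (e q).2) *
            ∑ w, StdFilling.polytabloid ℂ hNY T w *
              ∏ q, (fun i l : Fin N => if l = g i then (1 : ℂ) else 0) (σ (e q).1 (e q).2) (w q)) =
        if StdFilling.polytabloid ℂ hNY T (g ∘ fun q => σ (e q).1 (e q).2) ≠ 0 then 1 else 0 := by
    intro σ
    have hc : (∑ w, StdFilling.polytabloid ℂ hNY T w *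
        ∏ q, (fun i l : Fin N => if l = g i then (1 : ℂ) else 0) (σ (e q).1 (e q).2) (w q)) =
        StdFilling.polytabloid ℂ hNY T (g ∘ fun q => σ (e q).1 (e q).2) :=
      sum_mul_prod_indicator_eq _ g _
    have hval : ∀ s, (σ 0)⁻¹ (σ 1 s) ∈ H ↔ s ∈ H := fun s => by rw [hHv, hHv]
    rw [hc, ← mul_assoc, sign_mul_wordBlockSign_twist e e' H he' σ, if_pos hval, one_mul]
    by_cases hz : StdFilling.polytabloid ℂ hNY T (g ∘ fun q => σ (e q).1 (e q).2) = 0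
    · rw [if_neg (fun h => h hz), hz]
    · rw [if_pos hz]
      exact hVAL σ hz
  refine occurs_unitTensor_twoRectangle_of_pairing_ne_zero hNm e e' h0 h1 hM
    (fun i l => if l = g i then (1 : ℂ) else 0) ?_
  intro hsum
  rw [Finset.sum_congr rfl (fun σ _ => hterm σ), Finset.sum_boole, Nat.cast_eq_zero,
    Finset.card_eq_zero, Finset.filter_eq_empty_iff] at hsum
  -- the witness: `σ₀ = 1`, `σ₁ = (s₀ s₁)`
  obtain ⟨σw, hw0, hw1⟩ : ∃ σw : Fin 2 → Equiv.Perm (Fin N), σw 0 = 1 ∧ σw 1 = Equiv.swap s0 s1 :=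
    ⟨![1, Equiv.swap s0 s1], rfl, rfl⟩
  apply hsum (Finset.mem_univ σw)
  have hsw0 : ∀ s : Fin N, ((σw 0 s : Fin N) : ℕ) = (s : ℕ) := by intro s; rw [hw0, Equiv.Perm.one_apply]
  have hsw1 : ∀ s : Fin N, ((σw 1 s : Fin N) : ℕ) =
      if (s : ℕ) = 0 then 1 else if (s : ℕ) = 1 then 0 else (s : ℕ) := by
    intro s
    rw [hw1, Equiv.swap_apply_def]
    simp only [Fin.ext_iff, hs0, hs1]
    split_ifs <;> omega
  have hwrd : (g ∘ fun q => σw (e q).1 (e q).2) = StdFilling.rowWord hNY T := by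
    funext q
    obtain ⟨n, hn⟩ := q
    apply Fin.ext
    show _ = (T.1 ⟨n, hn⟩).1
    rw [hrowT]
    dsimp only
    by_cases hn4 : n < 4
    · have hcases : n = 0 ∨ n = 1 ∨ n = 2 ∨ n = 3 := by omega
      rcases hcases with rfl | rfl | rfl | rfl
      · rw [hpos σw 0 hn 0 s0 (by norm_num) (by norm_num [hs0]), hgv, hsw0]; simp [hs0]
      · rw [hpos σw 1 hn 1 s0 (by norm_num) (by norm_num [hs0]), hgv, hsw1]; simp [hs0]
      · rw [hpos σw 2 hn 1 s1 (by norm_num) (by norm_num [hs1]), hgv, hsw1]; simp [hs1]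
      · rw [hpos σw 3 hn 0 s1 (by norm_num) (by norm_num [hs1]), hgv, hsw0]; simp [hs1]
    · -- arm
      have ha : (if n = 2 then 3 else if n = 3 then 2 else n) % 2 =
          (((⟨n % 2, by omega⟩ : Fin 2) : Fin 2) : ℕ) := by dsimp only; split_ifs <;> omega
      have hs : (if n = 2 then 3 else if n = 3 then 2 else n) / 2 =
          (((⟨n / 2, by omega⟩ : Fin N) : Fin N) : ℕ) := by dsimp only; split_ifs <;> omega
      rw [hpos σw n hn ⟨n % 2, by omega⟩ ⟨n / 2, by omega⟩ ha hs, hgv]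
      have hfix : ((σw ⟨n % 2, by omega⟩ ⟨n / 2, by omega⟩ : Fin N) : ℕ) = n / 2 := by
        have : (⟨n % 2, by omega⟩ : Fin 2) = 0 ∨ (⟨n % 2, by omega⟩ : Fin 2) = 1 := by
          rcases Nat.mod_two_eq_zero_or_one n with h | h
          · left; exact Fin.ext h
          · right; exact Fin.ext h
        rcases this with h | h
        · rw [h, hsw0]
        · rw [h, hsw1]; dsimp only; split_ifs <;> omega
      rw [hfix]
      split_ifs <;> omega
  rw [hwrd, StdFilling.polytabloid_apply_rowWord]
  exact one_ne_zero

set_option maxHeartbeats 400000 in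
/-- `((2^N),(2^N),(2N))` occurs for `⟨m⟩` for all `m ≥ N ≥ 1` (the invariant end of the family: every colour is `0`,
every summand equals `1`). [cite: BurgisserIkenmeyer2011, Thm. 4.4] -/
theorem occurs_unitTensor_twoRectangle_doubleHook_zero {N m : ℕ} (hN : 1 ≤ N) (hNm : N ≤ m)
    {lam : Fin 3 → Nat.Partition (N * 2)} (h0 : lam 0 = Nat.Partition.rectangle N 2)
    (h1 : lam 1 = Nat.Partition.rectangle N 2)
    (h2 : (lam 2).sortedParts = (2 * N - 2 * 0) :: List.replicate 0 2) :
    isotypicSum₁ (lam 0) (isotypicSum₂ (lam 1) (isotypicSum₃ (lam 2)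
      (kroneckerPow (unitTensor ℂ m) (N * 2)))) ≠ 0 := by
  classical
  have hNY : ∀ x ∈ (lam 2).youngDiagram.cells, x.1 < N := fun x hx => by
    have := fst_lt_of_mem_youngDiagram_doubleHook (lam 2) h2 hx; omega
  have hd : (lam 2).youngDiagram.cells.card = N * 2 := Nat.Partition.card_cells_youngDiagram _
  obtain ⟨T, hT⟩ : ∃ T : StdFilling (N * 2) (lam 2).youngDiagram, ∀ p : Fin (N * 2), T.1 p =
      (if (p : ℕ) < 0 + 1 then ((p : ℕ), 0) else if (p : ℕ) < 2 * (0 + 1) then ((p : ℕ) - (0 + 1), 1)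
        else (0, (p : ℕ) - 2 * (0 + 1) + 2)) :=
    ⟨⟨fun p => if (p : ℕ) < 0 + 1 then ((p : ℕ), 0) else if (p : ℕ) < 2 * (0 + 1) then ((p : ℕ) - (0 + 1), 1)
        else (0, (p : ℕ) - 2 * (0 + 1) + 2),
      ⟨fun p => hookCell_mem_doubleHook (j := 0) hN (lam 2) h2 p p.2,
       fun p q hpq => Fin.ext (hookCell_injective (0 + 1) hpq),
       fun p q hpq => hookCell_standard (0 + 1) hpq⟩⟩, fun p => rfl⟩
  have hrowT : ∀ q : Fin (N * 2), (T.1 q).1 =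
      if (q : ℕ) < 0 + 1 then (q : ℕ) else if (q : ℕ) < 2 * (0 + 1) then (q : ℕ) - (0 + 1) else 0 := fun q => by
    rw [hT]; split_ifs <;> rfl
  have hM : StdFilling.polytabloid ℂ hNY T ∈
      highestWeightSpace (wordRep ℂ N (N * 2)) (Weight.ofPartition N (lam 2)) := by
    rw [← ydWeight_youngDiagram]; exact StdFilling.polytabloid_mem hNY T hd
  obtain ⟨s0, hs0⟩ : ∃ s : Fin N, (s : ℕ) = 0 := ⟨⟨0, by omega⟩, rfl⟩
  obtain ⟨e, he⟩ : ∃ e : Fin (N * 2) ≃ Fin 2 × Fin N,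
      e = finProdFinEquiv.symm.trans (Equiv.prodComm (Fin N) (Fin 2)) := ⟨_, rfl⟩
  obtain ⟨H, hH⟩ : ∃ H : Finset (Fin N), H = ∅ := ⟨_, rfl⟩
  have hHv : ∀ s : Fin N, s ∈ H ↔ False := by intro s; rw [hH]; simp
  obtain ⟨e', he'⟩ : ∃ e' : Fin (N * 2) ≃ Fin 2 × Fin N,
      ∀ q, e' q = (if (e q).2 ∈ H then Fin.rev (e q).1 else (e q).1, (e q).2) :=
    ⟨e, fun q => by rw [if_neg (fun h => (hHv _).1 h)]⟩
  obtain ⟨g, hg⟩ : ∃ g : Fin N → Fin N, ∀ i, g i = s0 := ⟨_, fun i => rfl⟩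
  -- every word `g ∘ w_σ` is the row word of `T` (all letters `0`)
  have hwrd : ∀ σ : Fin 2 → Equiv.Perm (Fin N), (g ∘ fun q => σ (e q).1 (e q).2) = StdFilling.rowWord hNY T := by
    intro σ
    funext q
    apply Fin.ext
    show ((g (σ (e q).1 (e q).2) : Fin N) : ℕ) = (T.1 q).1
    rw [hrowT, hg, hs0]
    split_ifs <;> omega
  have hterm : ∀ σ : Fin 2 → Equiv.Perm (Fin N),
      (∏ a, ((Equiv.Perm.sign (σ a) : ℤ) : ℂ)) *
          (wordBlockSign ℂ e' (fun q => σ (e q).1 (e q).2) *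
            ∑ w, StdFilling.polytabloid ℂ hNY T w *
              ∏ q, (fun i l : Fin N => if l = g i then (1 : ℂ) else 0) (σ (e q).1 (e q).2) (w q)) = 1 := by
    intro σ
    have hc : (∑ w, StdFilling.polytabloid ℂ hNY T w *
        ∏ q, (fun i l : Fin N => if l = g i then (1 : ℂ) else 0) (σ (e q).1 (e q).2) (w q)) =
        StdFilling.polytabloid ℂ hNY T (g ∘ fun q => σ (e q).1 (e q).2) :=
      sum_mul_prod_indicator_eq _ g _
    have hval : ∀ s, (σ 0)⁻¹ (σ 1 s) ∈ H ↔ s ∈ H := fun s => by rw [hHv, hHv]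
    rw [hc, ← mul_assoc, sign_mul_wordBlockSign_twist e e' H he' σ, if_pos hval, one_mul, hwrd σ,
      StdFilling.polytabloid_apply_rowWord]
  refine occurs_unitTensor_twoRectangle_of_pairing_ne_zero hNm e e' h0 h1 hM
    (fun i l => if l = g i then (1 : ℂ) else 0) ?_
  rw [Finset.sum_congr rfl (fun σ _ => hterm σ), Finset.sum_const, nsmul_eq_mul, mul_one, Nat.cast_ne_zero,
    Finset.card_univ]
  exact Fintype.card_ne_zero


end Summit.MatrixMultiplication.MatrixMultiplication.Theorems.ObstructionCalculus
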